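import Literature.AnabelianGeometry.SemiGraphs.PSCCompactification
import Literature.AnabelianGeometry.SemiGraphs.PSCCompactQuotientTransport

/-!
# [CombGC] Thm. 1.6 (ii), "replacing `G`, `H` by their compactifications": the hypotheses on `α` survive
# the passage to the compactifications (transfer companion, part 2)

Mochizuki, *A combinatorial version of the Grothendieck conjecture*, Tohoku Math. J. **59** (2007) [CombGC],
§1, Remark 1.1.6 p. 8 (the compactification `G'`: underlying semi-graph with the cusps omitted, verticial /
edge-like subgroups the images under `Π_G ↠ Π^cpt_G`) and the proof of Theorem 1.6 (ii), author's ms p. 14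
l.18–21 ("by replacing `G`, `H` by their respective compactifications … we may assume that `G`, `H` are
noncuspidal"). [cite: MochizukiCombGC2007, Rmk 1.1.6 p.8] [cite: MochizukiCombGC2007, Thm 1.6(ii) p.14]

PROOF-ONLY file (abc-iut cell, layer L3, `plan/L3/SUBDAG-CombGC-Thm16.md` row **T16-L09**; L3-lead α11-3:
the datum `PSCDatum.compactifyAlong` / `compactify` = abc-iut-L3-t4 g4 (`PSCCompactification.lean`,
p418457), transfer companion = abc-iut-w5-d188; part 1 = `PSCCompactQuotientTransport.lean`).  For
presentations `f : Π_G ↠ Q`, `f' : Π_H ↠ Q'` (continuous surjections from compact to Hausdorff groups, as in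
`compactifyAlong`) and an isomorphism `β : Q ≅ Q'` LYING OVER `α : Π_G ≅ Π_H` (`β ∘ f = f' ∘ α`), writing
`G' := G.compactifyAlong f …`, `H' := H.compactifyAlong f' …`:

* `exists_over_of_ker_map_eq` — such a `β` EXISTS as soon as `α(ker f) = ker f'` (e.g. `ker f = cptKer`,
  `α` group-theoretically cuspidal; unique by part 1 `over_unique`);
* verticial / edge-like / cuspidal CLASSES: `IsGroupTheoreticallyVerticial.compactifyAlong` (`α`
  group-theoretically verticial ⇒ `β` is), `isGroupTheoreticallyEdgeLike_compactifyAlong_of_nodal` (nodal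
  classes correspond under `α` ⇒ `β` group-theoretically edge-like: the edge-like subgroups of a
  compactification are its nodal ones), `isGroupTheoreticallyCuspidal_compactifyAlong` and
  `isNumericallyCuspidal_compactifyAlong` (vacuous: no cusps), `IsGraphic.compactifyAlong` (graphic ⇒ graphic);
* FILTRATIONS (Def. 1.1 (ii) / 1.4 (iii)): `map_inf_eq_of_ker_le`, `map_topologicalClosure_eq_of_isClosedMap`
  (plumbing), **`compactifyAlong_vertFil_map`** — for `ker f ≤ U`, `M^vert` of the covering of `G'` attached
  to `f(U)` is the image of `M^vert` of `G_U`: `G'.vertFil (f U) = f (G.vertFil U)` — and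
  **`compactifyAlong_edgeFil_map`** (the same for `M^edge`, provided the cuspidal subgroups die in `ker f`,
  `G.cptKer ≤ ker f`); hence **`IsVerticiallyFiltrationPreserving.compactifyAlong`**,
  **`IsEdgewiseFiltrationPreserving.compactifyAlong`**, **`IsGraphicallyFiltrationPreserving.compactifyAlong`**:
  if `α` is verticially / edgewise / graphically filtration-preserving and `α(ker f) = ker f'` then so is `β`
  — the hypothesis of Thm. 1.6 (ii) survives "replacing `G`, `H` by their compactifications";
* the canonical presentations (`compactify`, `f = Π ↠ Π ⧸ cptKer`): `…compactify` corollaries for a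
  group-theoretically cuspidal `α` and the `ᾱ` of part 1.
The DESCENT "`β` graphic ⇒ `α` graphic" (row T16-L09b) is NOT formal over the interface and is not claimed.
Pure proofs; no definitions; nothing here takes a side on [IUTchIII] Cor. 3.12.
-/

noncomputable section

namespace Literature.AnabelianGeometry.SemiGraphs

namespace PSCDatum

open scoped Pointwise

universe u

variable {P : Type u} [Group P] [TopologicalSpace P]
variable {P' : Type u} [Group P'] [TopologicalSpace P']
variable {Q : Type u} [Group Q] [TopologicalSpace Q]
variable {Q' : Type u} [Group Q'] [TopologicalSpace Q']

/-! ### Plumbing: images of intersections and of closures -/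

omit [TopologicalSpace P] [TopologicalSpace Q] in
/-- `f(U ∩ B) = f(U) ∩ f(B)` as soon as `ker f ≤ U`. [cite: MochizukiCombGC2007, Rmk 1.1.6 p.8] -/
theorem map_inf_eq_of_ker_le (f : P →* Q) {U : Subgroup P} (hU : f.ker ≤ U) (B : Subgroup P) :
    (U ⊓ B).map f = U.map f ⊓ B.map f := by
  refine le_antisymm (Subgroup.map_inf_le _ _ _) ?_
  intro y hy
  obtain ⟨⟨u, hu, huy⟩, ⟨b, hb, hby⟩⟩ := Subgroup.mem_inf.mp hy
  have hk : u⁻¹ * b ∈ f.ker := by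
    rw [MonoidHom.mem_ker, map_mul, map_inv, huy, hby, inv_mul_cancel]
  refine ⟨b, ⟨?_, hb⟩, hby⟩
  simpa using U.mul_mem hu (hU hk)

/-- A continuous CLOSED homomorphism carries topological closures of subgroups onto topological
closures (e.g. any continuous `f : Π ↠ Q` with `Π` compact, `Q` Hausdorff).
[cite: MochizukiCombGC2007, Rmk 1.1.6 p.8] -/
theorem map_topologicalClosure_eq_of_isClosedMap [IsTopologicalGroup P] [IsTopologicalGroup Q]
    (f : P →* Q) (hf : Continuous f) (hc : IsClosedMap f) (X : Subgroup P) :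
    X.topologicalClosure.map f = (X.map f).topologicalClosure := by
  apply le_antisymm
  · rw [← SetLike.coe_subset_coe, Subgroup.coe_map, Subgroup.topologicalClosure_coe,
      Subgroup.topologicalClosure_coe, Subgroup.coe_map]
    exact image_closure_subset_closure_image hf
  · refine Subgroup.topologicalClosure_minimal _ (Subgroup.map_mono X.le_topologicalClosure) ?_
    rw [Subgroup.coe_map]
    exact hc _ X.isClosed_topologicalClosure

/-! ### Existence of `β : Q ≅ Q'` over `α` for presentations with `α(ker f) = ker f'` -/

/-- **An isomorphism `β : Q ≅ Q'` over `α` exists** for presentations `f : Π ↠ Q`, `f' : Π' ↠ Q'`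
(continuous surjections, `Π`, `Π'` compact, `Q`, `Q'` Hausdorff) as soon as `α(ker f) = ker f'` — e.g.
`ker f = Ker(Π_G ↠ Π^cpt_G)`, `ker f' = Ker(Π_H ↠ Π^cpt_H)` and `α` group-theoretically cuspidal
(`map_cptKer_of_isGroupTheoreticallyCuspidal`).  Unique by `over_unique`.
[cite: MochizukiCombGC2007, Rmk 1.1.6 p.8] -/
theorem exists_over_of_ker_map_eq [IsTopologicalGroup P] [CompactSpace P] [IsTopologicalGroup P']
    [CompactSpace P'] [IsTopologicalGroup Q] [T2Space Q] [IsTopologicalGroup Q'] [T2Space Q']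
    (α : P ≃ₜ* P') {f : P →* Q} (hf : Continuous f) (hs : Function.Surjective f) {f' : P' →* Q'}
    (hf' : Continuous f') (hs' : Function.Surjective f')
    (hker : f.ker.map α.toMulEquiv.toMonoidHom = f'.ker) :
    ∃ β : Q ≃ₜ* Q', ∀ x : P, β (f x) = f' (α x) := by
  obtain ⟨q, hq⟩ := exists_quotient_equiv_of_map_eq α f.ker f'.ker hker
  let e : P ⧸ f.ker ≃* Q := QuotientGroup.quotientKerEquivOfSurjective f hs
  let e' : P' ⧸ f'.ker ≃* Q' := QuotientGroup.quotientKerEquivOfSurjective f' hs'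
  let b : Q ≃* Q' := e.symm.trans (q.toMulEquiv.trans e')
  have he : ∀ x : P, e (QuotientGroup.mk' f.ker x) = f x := fun x => rfl
  have he' : ∀ y : P', e' (QuotientGroup.mk' f'.ker y) = f' y := fun y => rfl
  have hb : ∀ x : P, b (f x) = f' (α x) := by
    intro x
    show e' (q (e.symm (f x))) = f' (α x)
    rw [← he x, MulEquiv.symm_apply_apply, hq, he']
  have hb' : ∀ y : P', b.symm (f' y) = f (α.symm y) := by
    intro y
    apply b.injective
    rw [MulEquiv.apply_symm_apply, hb, ContinuousMulEquiv.apply_symm_apply]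
  have hqf : Topology.IsQuotientMap f := hf.isClosedMap.isQuotientMap hf hs
  have hqf' : Topology.IsQuotientMap f' := hf'.isClosedMap.isQuotientMap hf' hs'
  have hcont : Continuous b := by
    rw [hqf.continuous_iff]
    have : (b : Q → Q') ∘ f = f' ∘ α := funext hb
    rw [this]
    exact hf'.comp α.continuous
  have hcont' : Continuous b.symm := by
    rw [hqf'.continuous_iff]
    have : (b.symm : Q' → Q) ∘ f' = f ∘ α.symm := funext hb'
    rw [this]
    exact hf.comp α.symm.continuous
  exact ⟨{ b with continuous_toFun := hcont, continuous_invFun := hcont' }, hb⟩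

/-! ### The compactifications along `f`, `f'` and an isomorphism `β` over `α` -/

section Transfer

variable [CompactSpace P] [CompactSpace P'] [T2Space Q] [T2Space Q']
variable (G : PSCDatum P) (H : PSCDatum P') {α : P ≃ₜ* P'}
variable (f : P →* Q) (hf : Continuous f) (hs : Function.Surjective f)
variable (f' : P' →* Q') (hf' : Continuous f') (hs' : Function.Surjective f')
variable {β : Q ≃ₜ* Q'}

/-! #### Classes of subgroups -/

/-- **`α` group-theoretically verticial ⇒ `β` group-theoretically verticial** for the compactifications
(their verticial subgroups are the images of those of `G`, `H`: `isVerticial_compactifyAlong_iff`).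
[cite: MochizukiCombGC2007, Thm 1.6(ii) p.14] -/
theorem IsGroupTheoreticallyVerticial.compactifyAlong (h : G.IsGroupTheoreticallyVerticial H α)
    (hβ : ∀ x : P, β (f x) = f' (α x)) :
    (G.compactifyAlong f hf hs).IsGroupTheoreticallyVerticial (H.compactifyAlong f' hf' hs') β := by
  constructor
  · intro A hA
    obtain ⟨B, hB, rfl⟩ := (G.isVerticial_compactifyAlong_iff f hf hs A).mp hA
    rw [map_map_eq_of_over hβ]
    exact (H.isVerticial_compactifyAlong_iff f' hf' hs' _).mpr ⟨_, h.1 B hB, rfl⟩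
  · intro B' hB'
    obtain ⟨B, hB, rfl⟩ := (H.isVerticial_compactifyAlong_iff f' hf' hs' B').mp hB'
    obtain ⟨A, hA, rfl⟩ := h.2 B hB
    exact ⟨A.map f, (G.isVerticial_compactifyAlong_iff f hf hs _).mpr ⟨A, hA, rfl⟩,
      map_map_eq_of_over hβ A⟩

/-- **Nodal classes corresponding under `α` ⇒ `β` group-theoretically edge-like** for the
compactifications (whose edge-like subgroups are the images of the NODAL subgroups of `G`, `H`:
`isEdgeLike_compactifyAlong_iff`). [cite: MochizukiCombGC2007, Thm 1.6(ii) p.14] -/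
theorem isGroupTheoreticallyEdgeLike_compactifyAlong_of_nodal
    (h₁ : ∀ A, G.IsNodal A → H.IsNodal (A.map α.toMulEquiv.toMonoidHom))
    (h₂ : ∀ B, H.IsNodal B → ∃ A, G.IsNodal A ∧ A.map α.toMulEquiv.toMonoidHom = B)
    (hβ : ∀ x : P, β (f x) = f' (α x)) :
    (G.compactifyAlong f hf hs).IsGroupTheoreticallyEdgeLike (H.compactifyAlong f' hf' hs') β := by
  constructor
  · intro A hA
    obtain ⟨B, hB, rfl⟩ := (G.isEdgeLike_compactifyAlong_iff f hf hs A).mp hA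
    rw [map_map_eq_of_over hβ]
    exact (H.isEdgeLike_compactifyAlong_iff f' hf' hs' _).mpr ⟨_, h₁ B hB, rfl⟩
  · intro B' hB'
    obtain ⟨B, hB, rfl⟩ := (H.isEdgeLike_compactifyAlong_iff f' hf' hs' B').mp hB'
    obtain ⟨A, hA, rfl⟩ := h₂ B hB
    exact ⟨A.map f, (G.isEdgeLike_compactifyAlong_iff f hf hs _).mpr ⟨A, hA, rfl⟩,
      map_map_eq_of_over hβ A⟩

/-- Between compactifications EVERY `β` is group-theoretically cuspidal (there are no cuspidal subgroups:
"we may assume that `G`, `H` are noncuspidal"). [cite: MochizukiCombGC2007, Thm 1.6(ii) p.14] -/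
theorem isGroupTheoreticallyCuspidal_compactifyAlong (β : Q ≃ₜ* Q') :
    (G.compactifyAlong f hf hs).IsGroupTheoreticallyCuspidal (H.compactifyAlong f' hf' hs') β :=
  ⟨fun A hA => (G.not_isCuspidal_compactifyAlong f hf hs A hA).elim,
    fun B hB => (H.not_isCuspidal_compactifyAlong f' hf' hs' B hB).elim⟩

/-- Between compactifications EVERY `β` is numerically cuspidal (`r = 0` for all coverings on both
sides). [cite: MochizukiCombGC2007, Thm 1.6(ii) p.14] -/
theorem isNumericallyCuspidal_compactifyAlong (β : Q ≃ₜ* Q') :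
    (G.compactifyAlong f hf hs).IsNumericallyCuspidal (H.compactifyAlong f' hf' hs') β :=
  fun U _ => by rw [compactifyAlong_cuspCount, compactifyAlong_cuspCount]

/-- **`α` graphic ⇒ `β` graphic** for the compactifications (via the same bijections of vertices and
nodes; the easy direction — the converse DESCENT is row T16-L09b and is not formal).
[cite: MochizukiCombGC2007, Thm 1.6(ii) p.14] -/
theorem IsGraphic.compactifyAlong (h : G.IsGraphic H α) (hβ : ∀ x : P, β (f x) = f' (α x)) :
    (G.compactifyAlong f hf hs).IsGraphic (H.compactifyAlong f' hf' hs') β := by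
  obtain ⟨ι, hv, hn, -⟩ := h
  let ι' : PSCSemiGraph.Iso (G.compactifyAlong f hf hs).graph (H.compactifyAlong f' hf' hs').graph :=
    PSCSemiGraph.Iso.mk ι.vertEquiv ι.nodeEquiv (Equiv.refl _) ι.nodeEnds_comm (fun c => c.elim0)
  refine ⟨ι', ?_, ?_, ?_⟩
  · intro v
    obtain ⟨γ, hγ⟩ := hv v
    refine ⟨ConjAct.toConjAct (f' (ConjAct.ofConjAct γ)), ?_⟩
    change ((G.vertGp v).map f).map β.toMulEquiv.toMonoidHom = _ • (H.vertGp (ι.vertEquiv v)).map f'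
    rw [map_map_eq_of_over hβ, hγ, map_conj_smul]
  · intro e
    obtain ⟨γ, hγ⟩ := hn e
    refine ⟨ConjAct.toConjAct (f' (ConjAct.ofConjAct γ)), ?_⟩
    change ((G.nodeGp e).map f).map β.toMulEquiv.toMonoidHom = _ • (H.nodeGp (ι.nodeEquiv e)).map f'
    rw [map_map_eq_of_over hβ, hγ, map_conj_smul]
  · intro c
    exact c.elim0

/-! #### The filtration `M^edge ⊆ M^vert ⊆ M` of the coverings of a compactification -/

variable [IsTopologicalGroup P] [IsTopologicalGroup P'] [IsTopologicalGroup Q] [IsTopologicalGroup Q']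

omit [IsTopologicalGroup P'] [CompactSpace P'] [IsTopologicalGroup Q'] [T2Space Q'] in
/-- **`M^vert` of the covering of `G'` attached to `f(U)` is the image of `M^vert` of `G_U`** (`ker f ≤ U`,
so that the `Π^cpt`-coverings of `G` and the coverings of `G'` correspond):
`G'.vertFil (f U) = f (G.vertFil U)` — the commutator and the verticial subgroups `U ∩ Π_v^γ` map onto
`f(U) ∩ f(Π_v)^{f γ}` (`map_inf_eq_of_ker_le`), and `f` is a closed map.
[cite: MochizukiCombGC2007, Def 1.1(ii) p.7] -/
theorem compactifyAlong_vertFil_map {U : Subgroup P} (hU : f.ker ≤ U) :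
    (G.compactifyAlong f hf hs).vertFil (U.map f) = (G.vertFil U).map f := by
  simp only [vertFil]
  rw [map_topologicalClosure_eq_of_isClosedMap f hf hf.isClosedMap, Subgroup.map_sup,
    Subgroup.map_commutator, Subgroup.map_iSup]
  congr 2
  apply le_antisymm
  · refine iSup_le fun A' => ?_
    obtain ⟨A', B', hB', rfl⟩ := A'
    obtain ⟨B, hB, rfl⟩ := (G.isVerticial_compactifyAlong_iff f hf hs B').mp hB'
    exact le_iSup_of_le ⟨U ⊓ B, B, hB, rfl⟩ (le_of_eq (map_inf_eq_of_ker_le f hU B).symm)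
  · refine iSup_le fun A => ?_
    obtain ⟨A, B, hB, rfl⟩ := A
    exact le_iSup_of_le ⟨U.map f ⊓ B.map f, B.map f,
      (G.isVerticial_compactifyAlong_iff f hf hs _).mpr ⟨B, hB, rfl⟩, rfl⟩
      (le_of_eq (map_inf_eq_of_ker_le f hU B))

omit [IsTopologicalGroup P'] [CompactSpace P'] [IsTopologicalGroup Q'] [T2Space Q'] in
/-- **`M^edge` of the covering of `G'` attached to `f(U)` is the image of `M^edge` of `G_U`**, provided
`ker f ≤ U` and the cuspidal subgroups of `Π_G` die in `Q` (`cptKer ≤ ker f`, as for every presentation of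
`Π^cpt_G`): the nodal pieces correspond as for `M^vert`, the cuspidal pieces of `M^edge_{G_U}` map to `1`.
[cite: MochizukiCombGC2007, Def 1.1(ii) p.7] -/
theorem compactifyAlong_edgeFil_map {U : Subgroup P} (hU : f.ker ≤ U) (hc : G.cptKer ≤ f.ker) :
    (G.compactifyAlong f hf hs).edgeFil (U.map f) = (G.edgeFil U).map f := by
  simp only [edgeFil]
  rw [map_topologicalClosure_eq_of_isClosedMap f hf hf.isClosedMap, Subgroup.map_sup,
    Subgroup.map_commutator, Subgroup.map_iSup]
  congr 2
  apply le_antisymm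
  · refine iSup_le fun A' => ?_
    obtain ⟨A', B', hB', rfl⟩ := A'
    obtain ⟨B, hB, rfl⟩ := (G.isEdgeLike_compactifyAlong_iff f hf hs B').mp hB'
    exact le_iSup_of_le ⟨U ⊓ B, B, Or.inl hB, rfl⟩ (le_of_eq (map_inf_eq_of_ker_le f hU B).symm)
  · refine iSup_le fun A => ?_
    obtain ⟨A, B, hB, rfl⟩ := A
    rcases hB with hB | hB
    · exact le_iSup_of_le ⟨U.map f ⊓ B.map f, B.map f,
        (G.isEdgeLike_compactifyAlong_iff f hf hs _).mpr ⟨B, hB, rfl⟩, rfl⟩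
        (le_of_eq (map_inf_eq_of_ker_le f hU B))
    · have hB0 : (U ⊓ B).map f = ⊥ := by
        rw [Subgroup.map_eq_bot_iff]
        obtain ⟨c, γ, rfl⟩ := hB
        exact inf_le_right.trans ((G.smul_cuspGp_le_cptKer c γ).trans hc)
      exact le_of_eq_of_le hB0 bot_le

/-! #### Filtration-preservation survives the passage to the compactifications -/

/-- **`α` verticially filtration-preserving ⇒ `β` verticially filtration-preserving** for the
compactifications, whenever `α(ker f) = ker f'`: for an open `Ū ≤ Q` put `U := f⁻¹(Ū)` (open, `⊇ ker f`,
`f(U) = Ū`); then `β(M^vert_{G'_Ū}) = β f (M^vert_{G_U}) = f' α (M^vert_{G_U}) = f' (M^vert_{H_{αU}})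
= M^vert_{H'_{f' α U}} = M^vert_{H'_{β Ū}}`. [cite: MochizukiCombGC2007, Thm 1.6(ii) p.14] -/
theorem IsVerticiallyFiltrationPreserving.compactifyAlong (h : G.IsVerticiallyFiltrationPreserving H α)
    (hker : f.ker.map α.toMulEquiv.toMonoidHom = f'.ker) (hβ : ∀ x : P, β (f x) = f' (α x)) :
    (G.compactifyAlong f hf hs).IsVerticiallyFiltrationPreserving (H.compactifyAlong f' hf' hs') β := by
  intro Ubar hUbar
  have hUopen : IsOpen ((Ubar.comap f : Subgroup P) : Set P) := hUbar.preimage hf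
  have hkU : f.ker ≤ Ubar.comap f := MonoidHom.ker_le_comap f Ubar
  have hkU' : f'.ker ≤ (Ubar.comap f).map α.toMulEquiv.toMonoidHom := by
    rw [← hker]; exact Subgroup.map_mono hkU
  have hUf : (Ubar.comap f).map f = Ubar := Subgroup.map_comap_eq_self_of_surjective hs Ubar
  calc ((G.compactifyAlong f hf hs).vertFil Ubar).map β.toMulEquiv.toMonoidHom
      = ((G.vertFil (Ubar.comap f)).map f).map β.toMulEquiv.toMonoidHom := by
          rw [← G.compactifyAlong_vertFil_map f hf hs hkU, hUf]
    _ = ((G.vertFil (Ubar.comap f)).map α.toMulEquiv.toMonoidHom).map f' := map_map_eq_of_over hβ _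
    _ = (H.vertFil ((Ubar.comap f).map α.toMulEquiv.toMonoidHom)).map f' := by rw [h _ hUopen]
    _ = (H.compactifyAlong f' hf' hs').vertFil
          (((Ubar.comap f).map α.toMulEquiv.toMonoidHom).map f') :=
          (H.compactifyAlong_vertFil_map f' hf' hs' hkU').symm
    _ = (H.compactifyAlong f' hf' hs').vertFil (((Ubar.comap f).map f).map β.toMulEquiv.toMonoidHom) := by
          rw [map_map_eq_of_over hβ]
    _ = (H.compactifyAlong f' hf' hs').vertFil (Ubar.map β.toMulEquiv.toMonoidHom) := by rw [hUf]

/-- **`α` edgewise filtration-preserving ⇒ `β` edgewise filtration-preserving** for the compactifications,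
whenever `α(ker f) = ker f'` and the cuspidal subgroups die in the presentations (`cptKer ≤ ker`).
[cite: MochizukiCombGC2007, Thm 1.6(ii) p.14] -/
theorem IsEdgewiseFiltrationPreserving.compactifyAlong (h : G.IsEdgewiseFiltrationPreserving H α)
    (hker : f.ker.map α.toMulEquiv.toMonoidHom = f'.ker) (hc : G.cptKer ≤ f.ker) (hc' : H.cptKer ≤ f'.ker)
    (hβ : ∀ x : P, β (f x) = f' (α x)) :
    (G.compactifyAlong f hf hs).IsEdgewiseFiltrationPreserving (H.compactifyAlong f' hf' hs') β := by
  intro Ubar hUbar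
  have hUopen : IsOpen ((Ubar.comap f : Subgroup P) : Set P) := hUbar.preimage hf
  have hkU : f.ker ≤ Ubar.comap f := MonoidHom.ker_le_comap f Ubar
  have hkU' : f'.ker ≤ (Ubar.comap f).map α.toMulEquiv.toMonoidHom := by
    rw [← hker]; exact Subgroup.map_mono hkU
  have hUf : (Ubar.comap f).map f = Ubar := Subgroup.map_comap_eq_self_of_surjective hs Ubar
  calc ((G.compactifyAlong f hf hs).edgeFil Ubar).map β.toMulEquiv.toMonoidHom
      = ((G.edgeFil (Ubar.comap f)).map f).map β.toMulEquiv.toMonoidHom := by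
          rw [← G.compactifyAlong_edgeFil_map f hf hs hkU hc, hUf]
    _ = ((G.edgeFil (Ubar.comap f)).map α.toMulEquiv.toMonoidHom).map f' := map_map_eq_of_over hβ _
    _ = (H.edgeFil ((Ubar.comap f).map α.toMulEquiv.toMonoidHom)).map f' := by rw [h _ hUopen]
    _ = (H.compactifyAlong f' hf' hs').edgeFil
          (((Ubar.comap f).map α.toMulEquiv.toMonoidHom).map f') :=
          (H.compactifyAlong_edgeFil_map f' hf' hs' hkU' hc').symm
    _ = (H.compactifyAlong f' hf' hs').edgeFil (((Ubar.comap f).map f).map β.toMulEquiv.toMonoidHom) := by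
          rw [map_map_eq_of_over hβ]
    _ = (H.compactifyAlong f' hf' hs').edgeFil (Ubar.map β.toMulEquiv.toMonoidHom) := by rw [hUf]

/-- **`α` graphically filtration-preserving ⇒ `β` graphically filtration-preserving** for the
compactifications (`α(ker f) = ker f'`, `cptKer ≤ ker` on both sides) — the hypothesis of Thm. 1.6 (ii)
survives "replacing `G`, `H` by their respective compactifications".
[cite: MochizukiCombGC2007, Thm 1.6(ii) p.14] -/
theorem IsGraphicallyFiltrationPreserving.compactifyAlong (h : G.IsGraphicallyFiltrationPreserving H α)
    (hker : f.ker.map α.toMulEquiv.toMonoidHom = f'.ker) (hc : G.cptKer ≤ f.ker) (hc' : H.cptKer ≤ f'.ker)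
    (hβ : ∀ x : P, β (f x) = f' (α x)) :
    (G.compactifyAlong f hf hs).IsGraphicallyFiltrationPreserving (H.compactifyAlong f' hf' hs') β :=
  ⟨h.1.compactifyAlong G H f hf hs f' hf' hs' hker hβ, h.2.compactifyAlong G H f hf hs f' hf' hs' hker hc hc' hβ⟩

end Transfer

/-! ### The canonical presentations: `G.compactify`, `H.compactify` and the `ᾱ` of part 1 -/

section Canonical

variable [IsTopologicalGroup P] [CompactSpace P] [IsTopologicalGroup P'] [CompactSpace P']
variable {G : PSCDatum P} {H : PSCDatum P'} {α : P ≃ₜ* P'}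
variable [G.cptKer.Normal] [H.cptKer.Normal]

omit [CompactSpace P] [CompactSpace P'] in
/-- For a group-theoretically cuspidal `α`, `α(Ker(Π_G ↠ Π^cpt_G)) = Ker(Π_H ↠ Π^cpt_H)` in the form the
canonical presentations `Π ↠ Π ⧸ cptKer` need. [cite: MochizukiCombGC2007, Def 1.4(iv) p.11] -/
theorem IsGroupTheoreticallyCuspidal.ker_mk'_map (h : G.IsGroupTheoreticallyCuspidal H α) :
    (QuotientGroup.mk' G.cptKer).ker.map α.toMulEquiv.toMonoidHom = (QuotientGroup.mk' H.cptKer).ker := by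
  rw [QuotientGroup.ker_mk', QuotientGroup.ker_mk']
  exact map_cptKer_of_isGroupTheoreticallyCuspidal h

/-- **Thm. 1.6 (ii), "replacing `G`, `H` by their compactifications"**: if `α : Π_G ≅ Π_H` is
group-theoretically cuspidal and graphically filtration-preserving, then the induced `ᾱ : Π^cpt_G ≅ Π^cpt_H`
(part 1, `IsGroupTheoreticallyCuspidal.exists_cptQuotient_equiv`; any `ᾱ` over `α`) is graphically
filtration-preserving between the compactifications `G.compactify`, `H.compactify` — which are
noncuspidal (`compactifyAlong_isNoncuspidal` data: no cusps) and sturdy iff `G`, `H` are.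
[cite: MochizukiCombGC2007, Thm 1.6(ii) p.14] -/
theorem IsGraphicallyFiltrationPreserving.compactify (h : G.IsGraphicallyFiltrationPreserving H α)
    (hc : G.IsGroupTheoreticallyCuspidal H α) {β : (P ⧸ G.cptKer) ≃ₜ* (P' ⧸ H.cptKer)}
    (hβ : ∀ x : P, β (QuotientGroup.mk' G.cptKer x) = QuotientGroup.mk' H.cptKer (α x)) :
    G.compactify.IsGraphicallyFiltrationPreserving H.compactify β := by
  haveI := G.t2Space_quotient_cptKer; haveI := H.t2Space_quotient_cptKer
  rw [compactify_eq, compactify_eq]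
  exact h.compactifyAlong G H _ _ _ _ _ _ hc.ker_mk'_map (by rw [QuotientGroup.ker_mk'])
    (by rw [QuotientGroup.ker_mk']) hβ

/-- Likewise: `α` group-theoretically verticial ⇒ `ᾱ` group-theoretically verticial between
`G.compactify` and `H.compactify`. [cite: MochizukiCombGC2007, Thm 1.6(ii) p.14] -/
theorem IsGroupTheoreticallyVerticial.compactify (h : G.IsGroupTheoreticallyVerticial H α)
    {β : (P ⧸ G.cptKer) ≃ₜ* (P' ⧸ H.cptKer)}
    (hβ : ∀ x : P, β (QuotientGroup.mk' G.cptKer x) = QuotientGroup.mk' H.cptKer (α x)) :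
    G.compactify.IsGroupTheoreticallyVerticial H.compactify β := by
  haveI := G.t2Space_quotient_cptKer; haveI := H.t2Space_quotient_cptKer
  rw [compactify_eq, compactify_eq]
  exact h.compactifyAlong G H _ _ _ _ _ _ hβ

/-- Likewise: every `β` between `G.compactify` and `H.compactify` is group-theoretically cuspidal.
[cite: MochizukiCombGC2007, Thm 1.6(ii) p.14] -/
theorem isGroupTheoreticallyCuspidal_compactify (β : (P ⧸ G.cptKer) ≃ₜ* (P' ⧸ H.cptKer)) :
    G.compactify.IsGroupTheoreticallyCuspidal H.compactify β := by
  haveI := G.t2Space_quotient_cptKer; haveI := H.t2Space_quotient_cptKer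
  rw [compactify_eq, compactify_eq]
  exact isGroupTheoreticallyCuspidal_compactifyAlong G H _ _ _ _ _ _ β

/-- Likewise: `α` graphic ⇒ `ᾱ` graphic between `G.compactify` and `H.compactify`.
[cite: MochizukiCombGC2007, Thm 1.6(ii) p.14] -/
theorem IsGraphic.compactify (h : G.IsGraphic H α) {β : (P ⧸ G.cptKer) ≃ₜ* (P' ⧸ H.cptKer)}
    (hβ : ∀ x : P, β (QuotientGroup.mk' G.cptKer x) = QuotientGroup.mk' H.cptKer (α x)) :
    G.compactify.IsGraphic H.compactify β := by
  haveI := G.t2Space_quotient_cptKer; haveI := H.t2Space_quotient_cptKer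
  rw [compactify_eq, compactify_eq]
  exact h.compactifyAlong G H _ _ _ _ _ _ hβ

end Canonical

end PSCDatum

end Literature.AnabelianGeometry.SemiGraphs
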